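import Mathlib
import HarnessLib
import Literature.Probability.LatticeModels.TorusCentredLift
import Literature.MathematicalPhysics.QuantumLattice.HubbardGridFieldSubstitution

/-!
# Route `KLProgramme` — crux K3, the nested two-volume pass (β′): the BLOCK GEOMETRY of the nested site torus `(ℤ/bm)^d ⊃ b^d` boxes `≅ (ℤ/m)^d`
# and of the grid legs over it — the block structure `e`, the zone, and the separation facts (G1)/(G2) of `…TwoVolumeBlockDefect`
# (cell gate-hubbard-kl, seat hubbard-kl-k3c4-p1 g7)

For `M = b·m`: a site `x : TorusSite d M` has block `blk x = (⌊x_i/m⌋)_i : Fin d → Fin b` and reduction `red x = (x_i mod m)_i : TorusSite d m`;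
`x` is `R`-DEEP when every residue `x_i mod m` lies in `[R, m − 1 − R]` (sup-distance `> R`... `≥ R` to the box boundary), and the ZONE is the
complement.  Separation is the torus sup-distance `Torus.tnorm (x − y)` (centred representatives, `TorusCentredLift`).  Proved:

* §1 one coordinate: `le_natAbs_cRepZ_sub` (`K ≤ |cRepZ (a − c)|` from `K ≤ |a.val − c.val| ≤ M − K`), **`succ_le_natAbs_cRepZ_sub_of_block_ne`**
  (different blocks `⌊a/m⌋ ≠ ⌊c/m⌋` and one of `a, c` `R`-deep ⇒ `R + 1 ≤ |cRepZ (a − c)|`), `succ_le_natAbs_cRepZ_sub_of_not_deep` (a non-deep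
  residue is at cyclic distance `≥ R′ + 1` from an `(R + R′)`-deep one, on `ℤ/m`);
* §2 the block structure: **`siteBlockEquiv`** `TorusSite d M ≃ (Fin d → Fin b) × TorusSite d m` (`x ↦ (blk x, red x)`, inverse `(q, r) ↦ (m q_i + r_i)_i`)
  and **`gridLegBlockEquiv`** `GridLeg (GridPoint M N) ≃ (Fin 2 → Fin b) × GridLeg (GridPoint m N)` (time, spin, charge untouched), with their
  `_fst`/`_snd` read-outs; `sum_fibre_gridLeg` (a fibre of the leg projection is a fibre of the site reduction);
* §3 the separation facts for `Zs = {X′ | site X′ not R-deep}`, `Far X′ Y′ = R < tnorm (site X′ − site Y′)`: **`far_of_block_ne`** (G1: different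
  blocks, not both in the zone ⇒ far), **`far_of_fibre_ne`** (G2: same block, `Y″ ≠ Y′` in the fibre of `Y′`, not both in the zone ⇒ `Y″` far from
  `X′`), `far_of_not_deep_of_deep` (a zone leg is far from an `(R+R′)`-deep pin: the `R ≤ d X` input of the far step, `d = tnorm (site · − site w)`);
* §4 `sum_filter_le_div_of_weight` (a tail over `{R < w}` is `≤ (R+1)⁻¹ ×` the `w`-first moment) — the tail `T` of the near sizes from a first
  spatial moment of the fine covariance.

Pure torus/leg geometry; sorry-free; no definition (the block structure is an `Equiv` built in the statement of `siteBlockEquiv`… see §2).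
References: BETA-PRIME-ROADMAP.md (k3c5-p2 g5) (m1)/(m2); VL-E3F-ROADMAP.md §3.
-/

noncomputable section

namespace Summit.HubbardSuperconductivity.HubbardSuperconductivity.Theorems.TwoVolumeDefect

set_option linter.dupNamespace false -- summit = problem name (single-conjunct summit), D-0017

open Finset Literature.MathematicalPhysics.QuantumLattice Literature.Probability.LatticeModels

/-! ## §1 One coordinate: cyclic distances across blocks -/

section OneCoordinate

variable {M : ℕ} [NeZero M]

/-- **Lower bound on a centred representative of a difference**: if the plain difference of the representatives `a.val − c.val` has
`K ≤ |a.val − c.val|` and `|a.val − c.val| + K ≤ M`, then `K ≤ |cRepZ (a − c)|`. [folklore] -/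
theorem le_natAbs_cRepZ_sub {a c : ZMod M} {K : ℕ} (h1 : (K : ℤ) ≤ |((a.val : ℤ) - c.val)|)
    (h2 : |((a.val : ℤ) - c.val)| + K ≤ M) : K ≤ (Torus.cRepZ (a - c)).natAbs := by
  have hrep : ((Torus.cRepZ (a - c) : ℤ) : ZMod M) = (((a.val : ℤ) - c.val : ℤ) : ZMod M) := by
    rw [Torus.intCast_cRepZ, Int.cast_sub, Int.cast_natCast, Int.cast_natCast, ZMod.natCast_zmod_val, ZMod.natCast_zmod_val]
  have hb : 2 * (Torus.cRepZ (a - c)).natAbs ≤ M := Torus.two_mul_natAbs_cRepZ_le (a - c)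
  have hK : (K : ℤ) ≤ |Torus.cRepZ (a - c)| := by
    rcases Torus.sub_repr_dichotomy hrep with h | h
    · rw [h]; exact h1
    · have h3 : |Torus.cRepZ (a - c) - ((a.val : ℤ) - c.val)| ≤ |Torus.cRepZ (a - c)| + |((a.val : ℤ) - c.val)| := abs_sub _ _
      linarith
  have : ((K : ℕ) : ℤ) ≤ ((Torus.cRepZ (a - c)).natAbs : ℤ) := by rwa [Int.natCast_natAbs]
  exact_mod_cast this

/-- **Different blocks, one deep ⇒ cyclic distance `≥ R + 1`.**  For `M = b·m`, representatives `a, c : ℤ/M` in different blocks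
(`⌊a/m⌋ ≠ ⌊c/m⌋`) one of which is `R`-deep in its block (`R ≤ · mod m ≤ m − 1 − R`) satisfy `R + 1 ≤ |cRepZ (a − c)|`: a deep point is
more than `R` away from every point of every other block, around the torus both ways. [folklore] -/
theorem succ_le_natAbs_cRepZ_sub_of_block_ne {b m : ℕ} (hM : M = b * m) {a c : ZMod M} {R : ℕ} (hblk : a.val / m ≠ c.val / m)
    (hdeep : (R ≤ a.val % m ∧ a.val % m + R < m) ∨ (R ≤ c.val % m ∧ c.val % m + R < m)) :
    R + 1 ≤ (Torus.cRepZ (a - c)).natAbs := by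
  have ha : a.val < M := ZMod.val_lt a
  have hc : c.val < M := ZMod.val_lt c
  have hda := Nat.div_add_mod a.val m
  have hdc := Nat.div_add_mod c.val m
  have hm0 : m ≠ 0 := by rintro rfl; simp at hdeep
  have hma : a.val % m < m := Nat.mod_lt _ (Nat.pos_of_ne_zero hm0)
  have hmc : c.val % m < m := Nat.mod_lt _ (Nat.pos_of_ne_zero hm0)
  -- name the block data
  set qa := a.val / m with hqa
  set qc := c.val / m with hqc
  set ra := a.val % m with hra
  set rc := c.val % m with hrc
  -- the two block orders
  have key : (R : ℤ) + 1 ≤ |((a.val : ℤ) - c.val)| ∧ |((a.val : ℤ) - c.val)| + (R + 1) ≤ M := by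
    rcases Nat.lt_or_gt_of_ne hblk with hlt | hlt
    · -- `qa < qc`: `c − a ≥ m + rc − ra`
      have h1 : m * qa + m ≤ m * qc := by
        have := Nat.mul_le_mul_left m (Nat.succ_le_of_lt hlt); rw [Nat.mul_succ] at this; exact this
      have hcM : m * qc + m ≤ M := by
        have hqcb : qc < b := by
          by_contra hh; push Not at hh
          have : b * m ≤ m * qc := by rw [mul_comm]; exact Nat.mul_le_mul_left m hh
          omega
        have := Nat.mul_le_mul_left m (Nat.succ_le_of_lt hqcb); rw [Nat.mul_succ] at this; rw [hM, mul_comm b]; exact this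
      constructor
      · rw [abs_of_nonpos (by omega)]; omega
      · rw [abs_of_nonpos (by omega)]; omega
    · -- `qc < qa`
      have h1 : m * qc + m ≤ m * qa := by
        have := Nat.mul_le_mul_left m (Nat.succ_le_of_lt hlt); rw [Nat.mul_succ] at this; exact this
      have haM : m * qa + m ≤ M := by
        have hqab : qa < b := by
          by_contra hh; push Not at hh
          have : b * m ≤ m * qa := by rw [mul_comm]; exact Nat.mul_le_mul_left m hh
          omega
        have := Nat.mul_le_mul_left m (Nat.succ_le_of_lt hqab); rw [Nat.mul_succ] at this; rw [hM, mul_comm b]; exact this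
      constructor
      · rw [abs_of_nonneg (by omega)]; omega
      · rw [abs_of_nonneg (by omega)]; omega
  exact le_natAbs_cRepZ_sub (by exact_mod_cast key.1) (by exact_mod_cast key.2)

/-- **A non-deep residue is far from a deeper one** (on ONE block `ℤ/m`): if `u` is NOT `R`-deep and `v` is `(R + R′)`-deep then
`R′ + 1 ≤ |cRepZ (u − v)|` — the zone is at cyclic distance `> R′` from a pin at depth `≥ R + R′`. [folklore] -/
theorem succ_le_natAbs_cRepZ_sub_of_not_deep {m : ℕ} [NeZero m] {u v : ZMod m} {R R' : ℕ} (hu : ¬ (R ≤ u.val ∧ u.val + R < m))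
    (hv : R + R' ≤ v.val ∧ v.val + (R + R') < m) : R' + 1 ≤ (Torus.cRepZ (u - v)).natAbs := by
  have hum : u.val < m := ZMod.val_lt u
  refine le_natAbs_cRepZ_sub ?_ ?_
  · rcases le_or_gt (v.val : ℤ) u.val with h | h
    · rw [abs_of_nonneg (by omega)]; push_cast; omega
    · rw [abs_of_neg (by omega)]; push_cast; omega
  · rcases le_or_gt (v.val : ℤ) u.val with h | h
    · rw [abs_of_nonneg (by omega)]; push_cast; omega
    · rw [abs_of_neg (by omega)]; push_cast; omega

end OneCoordinate

/-! ## §2 The block structure of the nested torus and of the grid legs over it -/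

section Blocks

variable {d b m M : ℕ} [NeZero M] [NeZero m]

omit [NeZero m] in
/-- A block index is `< b`. [folklore] -/
theorem val_div_lt (hM : M = b * m) (a : ZMod M) : a.val / m < b := by
  have ha : a.val < m * b := by have := ZMod.val_lt a; rw [mul_comm]; omega
  exact Nat.div_lt_of_lt_mul ha

omit [NeZero M] in
/-- The representative `m·q + r` of block `q`, residue `r` is `< M`, so its class has this value. [folklore] -/
theorem val_natCast_blockLift (hM : M = b * m) (q : Fin b) (r : ZMod m) :
    (((m * (q : ℕ) + r.val : ℕ)) : ZMod M).val = m * q + r.val := by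
  rw [ZMod.val_natCast, Nat.mod_eq_of_lt]
  have hr : r.val < m := ZMod.val_lt r
  have hq : (q : ℕ) + 1 ≤ b := q.isLt
  calc m * q + r.val < m * q + m := by omega
    _ = m * (q + 1) := by ring
    _ ≤ m * b := Nat.mul_le_mul_left m hq
    _ = M := by rw [hM, mul_comm]

/-- **THE BLOCK STRUCTURE OF THE NESTED SITE TORUS EXISTS**: for `M = b·m` there is a bijection `TorusSite d M ≃ (Fin d → Fin b) × TorusSite d m`
whose first component is the block `(⌊x_i/m⌋)_i` and whose second is the reduction `(x_i mod m)_i` (inverse `(q, r) ↦ (m q_i + r_i)_i`). [folklore] -/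
theorem exists_siteBlockEquiv (hM : M = b * m) :
    ∃ eS : TorusSite d M ≃ (Fin d → Fin b) × TorusSite d m,
      (∀ x i, ((eS x).1 i : ℕ) = (x i).val / m) ∧ (∀ x, (eS x).2 = fun i => (((x i).val : ℕ) : ZMod m)) := by
  refine ⟨{ toFun := fun x => (fun i => ⟨(x i).val / m, val_div_lt hM (x i)⟩, fun i => (((x i).val : ℕ) : ZMod m))
            invFun := fun p => fun i => (((m * (p.1 i : ℕ) + (p.2 i).val : ℕ)) : ZMod M)
            left_inv := ?_
            right_inv := ?_ }, fun x i => rfl, fun x => rfl⟩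
  · intro x
    funext i
    dsimp only
    rw [ZMod.val_natCast, Nat.div_add_mod, ZMod.natCast_zmod_val]
  · rintro ⟨q, r⟩
    refine Prod.ext (funext fun i => Fin.ext ?_) (funext fun i => ?_)
    · dsimp only
      rw [val_natCast_blockLift hM (q i) (r i), Nat.mul_add_div (Nat.pos_of_ne_zero (NeZero.ne m)),
        Nat.div_eq_of_lt (ZMod.val_lt (r i)), add_zero]
    · dsimp only
      rw [val_natCast_blockLift hM (q i) (r i), Nat.cast_add, Nat.cast_mul, ZMod.natCast_self, zero_mul, zero_add,
        ZMod.natCast_zmod_val]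

/-- **THE BLOCK STRUCTURE OF THE GRID LEGS** over the nested torus (time, spin, charge untouched): a bijection
`GridLeg (GridPoint M N) ≃ (Fin 2 → Fin b) × GridLeg (GridPoint m N)` with block `= (⌊x_i/m⌋)_i` of the site and projection
`(((j, x), σ), c) ↦ (((j, red x), σ), c)`. [folklore] -/
theorem exists_gridLegBlockEquiv {b m M : ℕ} [NeZero M] [NeZero m] (hM : M = b * m) (N : ℕ) :
    ∃ e : GridLeg (GridPoint M N) ≃ (Fin 2 → Fin b) × GridLeg (GridPoint m N),
      (∀ X' i, ((e X').1 i : ℕ) = (X'.1.1.2 i).val / m) ∧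
        (∀ X', (e X').2 = (((X'.1.1.1, fun i => (((X'.1.1.2 i).val : ℕ) : ZMod m)), X'.1.2), X'.2)) := by
  obtain ⟨eS, hS1, hS2⟩ := exists_siteBlockEquiv (d := 2) hM
  refine ⟨{ toFun := fun X' => ((eS X'.1.1.2).1, (((X'.1.1.1, (eS X'.1.1.2).2), X'.1.2), X'.2))
            invFun := fun p => (((p.2.1.1.1, eS.symm (p.1, p.2.1.1.2)), p.2.1.2), p.2.2)
            left_inv := ?_
            right_inv := ?_ }, fun X' i => hS1 _ i, fun X' => by
              show (((X'.1.1.1, (eS X'.1.1.2).2), X'.1.2), X'.2) = _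
              rw [hS2]⟩
  · rintro ⟨⟨⟨j, x⟩, σ⟩, c⟩
    simp
  · rintro ⟨q, ⟨⟨⟨j, y⟩, σ⟩, c⟩⟩
    simp

/-- **A fibre of the leg projection is a fibre of the site reduction** (time, spin and charge are read off the target leg). [folklore] -/
theorem sum_fibre_gridLeg {b m M : ℕ} [NeZero M] [NeZero m] {N : ℕ} {A : Type*} [AddCommMonoid A]
    (e : GridLeg (GridPoint M N) ≃ (Fin 2 → Fin b) × GridLeg (GridPoint m N))
    (he2 : ∀ X', (e X').2 = (((X'.1.1.1, fun i => (((X'.1.1.2 i).val : ℕ) : ZMod m)), X'.1.2), X'.2))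
    (F : GridLeg (GridPoint M N) → A) (Y : GridLeg (GridPoint m N)) :
    ∑ Y'' ∈ univ.filter (fun Y'' : GridLeg (GridPoint M N) => (e Y'').2 = Y), F Y'' =
      ∑ x' ∈ univ.filter (fun x' : TorusSite 2 M => (fun i => (((x' i).val : ℕ) : ZMod m)) = Y.1.1.2), F (((Y.1.1.1, x'), Y.1.2), Y.2) := by
  classical
  refine Finset.sum_bij' (fun Y'' _ => Y''.1.1.2) (fun x' _ => (((Y.1.1.1, x'), Y.1.2), Y.2)) ?_ ?_ ?_ ?_ ?_
  · intro Y'' hY''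
    simp only [mem_filter, mem_univ, true_and] at hY'' ⊢
    rw [he2] at hY''
    rw [← hY'']
  · intro x' hx'
    simp only [mem_filter, mem_univ, true_and] at hx' ⊢
    rw [he2, hx']
  · intro Y'' hY''
    simp only [mem_filter, mem_univ, true_and] at hY''
    rw [he2] at hY''
    rw [← hY'']
  · intro x' hx'
    rfl
  · intro Y'' hY''
    simp only [mem_filter, mem_univ, true_and] at hY''
    rw [he2] at hY''
    rw [← hY'']

end Blocks

/-! ## §3 Separation facts for the zone `{not R-deep}` and `Far = R < tnorm (site − site)` -/

section Far

variable {d b m M : ℕ} [NeZero M] [NeZero m]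

omit [NeZero M] [NeZero m] in
/-- A coordinate of the centred lift is bounded by the torus norm. [folklore] -/
theorem natAbs_cRepZ_apply_le_tnorm (z : TorusSite d M) (i : Fin d) : (Torus.cRepZ (z i)).natAbs ≤ Torus.tnorm z :=
  Site.natAbs_le_supNorm (Torus.cRep z) i

omit [NeZero m] in
/-- **(G1) on sites**: different blocks and one of the two sites `R`-deep ⇒ `R < tnorm (x − y)`. [folklore] -/
theorem tnorm_sub_gt_of_block_ne (hM : M = b * m) {R : ℕ} {x y : TorusSite d M} {i : Fin d} (hblk : (x i).val / m ≠ (y i).val / m)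
    (hdeep : (∀ j, R ≤ (x j).val % m ∧ (x j).val % m + R < m) ∨ (∀ j, R ≤ (y j).val % m ∧ (y j).val % m + R < m)) :
    R < Torus.tnorm (x - y) := by
  have h := succ_le_natAbs_cRepZ_sub_of_block_ne hM hblk (hdeep.imp (fun h => h i) (fun h => h i))
  have h2 := natAbs_cRepZ_apply_le_tnorm (x - y) i
  rw [Pi.sub_apply] at h2
  omega

omit [NeZero m] in
/-- Equal reductions and equal blocks in a coordinate force equal coordinates. [folklore] -/
theorem apply_eq_of_red_eq_of_block_eq {y'' y' : TorusSite d M} {i : Fin d}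
    (hred : (((y'' i).val : ℕ) : ZMod m) = (((y' i).val : ℕ) : ZMod m)) (hblk : (y'' i).val / m = (y' i).val / m) : y'' i = y' i := by
  rw [ZMod.natCast_eq_natCast_iff'] at hred
  apply ZMod.val_injective
  rw [← Nat.div_add_mod (y'' i).val m, ← Nat.div_add_mod (y' i).val m, hred, hblk]

omit [NeZero m] in
/-- **(G1) on grid legs**: for a block structure `e` with block `⌊x/m⌋`, legs in different blocks, not both in the zone, are far:
`R < tnorm (site X′ − site Y′)`. [folklore] -/
theorem far_of_block_ne {N : ℕ} (hM : M = b * m) (e : GridLeg (GridPoint M N) ≃ (Fin 2 → Fin b) × GridLeg (GridPoint m N))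
    (he1 : ∀ X' i, ((e X').1 i : ℕ) = (X'.1.1.2 i).val / m) {R : ℕ} {X' Y' : GridLeg (GridPoint M N)} (hne : (e X').1 ≠ (e Y').1)
    (hnz : ¬ ((¬ ∀ j, R ≤ (X'.1.1.2 j).val % m ∧ (X'.1.1.2 j).val % m + R < m) ∧
              (¬ ∀ j, R ≤ (Y'.1.1.2 j).val % m ∧ (Y'.1.1.2 j).val % m + R < m))) :
    R < Torus.tnorm (X'.1.1.2 - Y'.1.1.2) := by
  obtain ⟨i, hi⟩ : ∃ i, (e X').1 i ≠ (e Y').1 i := by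
    by_contra h
    push Not at h
    exact hne (funext h)
  have hblk : (X'.1.1.2 i).val / m ≠ (Y'.1.1.2 i).val / m := by
    rw [← he1, ← he1]
    exact fun h => hi (Fin.ext h)
  refine tnorm_sub_gt_of_block_ne hM hblk ?_
  by_contra h
  exact hnz ⟨fun hA => h (Or.inl hA), fun hB => h (Or.inr hB)⟩

omit [NeZero m] in
/-- **(G2) on grid legs**: inside a block, a leg `Y″ ≠ Y′` of the fibre of `Y′` is a WINDING image of `Y′`, hence far from every `X′` of the block
when not both of `X′, Y′` are in the zone: `R < tnorm (site X′ − site Y″)`. [folklore] -/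
theorem far_of_fibre_ne {N : ℕ} (hM : M = b * m) (e : GridLeg (GridPoint M N) ≃ (Fin 2 → Fin b) × GridLeg (GridPoint m N))
    (he1 : ∀ X' i, ((e X').1 i : ℕ) = (X'.1.1.2 i).val / m)
    (he2 : ∀ X', (e X').2 = (((X'.1.1.1, fun i => (((X'.1.1.2 i).val : ℕ) : ZMod m)), X'.1.2), X'.2))
    {R : ℕ} {X' Y' Y'' : GridLeg (GridPoint M N)} (hblk : (e X').1 = (e Y').1) (hfib : (e Y'').2 = (e Y').2) (hne : Y'' ≠ Y')
    (hnz : ¬ ((¬ ∀ j, R ≤ (X'.1.1.2 j).val % m ∧ (X'.1.1.2 j).val % m + R < m) ∧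
              (¬ ∀ j, R ≤ (Y'.1.1.2 j).val % m ∧ (Y'.1.1.2 j).val % m + R < m))) :
    R < Torus.tnorm (X'.1.1.2 - Y''.1.1.2) := by
  rw [he2, he2] at hfib
  simp only [Prod.mk.injEq] at hfib
  obtain ⟨⟨⟨hj, hred⟩, hσ⟩, hc⟩ := hfib
  -- the sites differ (else the legs would coincide)
  have hsite : Y''.1.1.2 ≠ Y'.1.1.2 := by
    intro h
    apply hne
    exact Prod.ext (Prod.ext (Prod.ext hj h) hσ) hc
  obtain ⟨i, hi⟩ : ∃ i, Y''.1.1.2 i ≠ Y'.1.1.2 i := by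
    by_contra h
    push Not at h
    exact hsite (funext h)
  have hredi : (((Y''.1.1.2 i).val : ℕ) : ZMod m) = (((Y'.1.1.2 i).val : ℕ) : ZMod m) := congr_fun hred i
  -- so their blocks differ in the coordinate `i`, while `X′` shares the block of `Y′`
  have hbY : (Y''.1.1.2 i).val / m ≠ (Y'.1.1.2 i).val / m := fun h => hi (apply_eq_of_red_eq_of_block_eq hredi h)
  have hbX : (X'.1.1.2 i).val / m = (Y'.1.1.2 i).val / m := by
    rw [← he1, ← he1, hblk]
  have hblk' : (X'.1.1.2 i).val / m ≠ (Y''.1.1.2 i).val / m := by rw [hbX]; exact fun h => hbY h.symm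
  -- depth: `X′` deep, or `Y′` deep (and then `Y″`, with the same residues, is deep in the coordinate `i`)
  have hresi : (Y''.1.1.2 i).val % m = (Y'.1.1.2 i).val % m := (ZMod.natCast_eq_natCast_iff' _ _ _).1 hredi
  refine lt_of_lt_of_le ?_ (natAbs_cRepZ_apply_le_tnorm (X'.1.1.2 - Y''.1.1.2) i)
  rw [Pi.sub_apply]
  refine Nat.lt_of_succ_le (succ_le_natAbs_cRepZ_sub_of_block_ne hM hblk' ?_)
  by_contra h
  apply hnz
  refine ⟨fun hX => h (Or.inl (hX i)), fun hY => h (Or.inr ?_)⟩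
  have := hY i
  rwa [← hresi] at this

/-- Reduction `ℤ/M → ℤ/m` does not increase centred absolute values (the coarse representative is minimal). [folklore] -/
theorem natAbs_cRepZ_red_le (hM : M = b * m) (z : ZMod M) :
    (Torus.cRepZ ((z.val : ℕ) : ZMod m)).natAbs ≤ (Torus.cRepZ z).natAbs := by
  refine Torus.natAbs_cRepZ_le ?_
  have hdvd : m ∣ M := ⟨b, by rw [hM, mul_comm]⟩
  have h1 : ((Torus.cRepZ z : ℤ) : ZMod m) = ZMod.castHom hdvd (ZMod m) ((Torus.cRepZ z : ℤ) : ZMod M) := by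
    rw [map_intCast]
  rw [h1, Torus.intCast_cRepZ, ZMod.castHom_apply, ZMod.cast_eq_val]

/-- **A zone site is far from a deep pin**: if `x` is not `R`-deep and `w` is `(R + R′)`-deep then `R′ < tnorm (x − w)` — the `R ≤ d X` input of the
far step for `d = tnorm (site · − site w)` at a pin `w` of depth `≥ R + R′` (a block centre: `R′ ≈ m/2 − R`). [folklore] -/
theorem far_of_not_deep_of_deep (hM : M = b * m) {R R' : ℕ} {x w : TorusSite d M} (hx : ¬ ∀ j, R ≤ (x j).val % m ∧ (x j).val % m + R < m)
    (hw : ∀ j, R + R' ≤ (w j).val % m ∧ (w j).val % m + (R + R') < m) : R' < Torus.tnorm (x - w) := by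
  push Not at hx
  obtain ⟨i, hi⟩ := hx
  have hu : ¬ (R ≤ ((((x i).val : ℕ) : ZMod m)).val ∧ ((((x i).val : ℕ) : ZMod m)).val + R < m) := by
    rw [ZMod.val_natCast]; exact fun h => absurd (hi h.1) (not_le.2 h.2)
  have hv : R + R' ≤ ((((w i).val : ℕ) : ZMod m)).val ∧ ((((w i).val : ℕ) : ZMod m)).val + (R + R') < m := by
    rw [ZMod.val_natCast]; exact hw i
  have h1 := succ_le_natAbs_cRepZ_sub_of_not_deep hu hv
  have h2 : (Torus.cRepZ ((((x i).val : ℕ) : ZMod m) - (((w i).val : ℕ) : ZMod m))).natAbs ≤ (Torus.cRepZ (x i - w i)).natAbs := by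
    have hred : (((x i).val : ℕ) : ZMod m) - (((w i).val : ℕ) : ZMod m) = ((((x i - w i).val : ℕ)) : ZMod m) := by
      have hdvd : m ∣ M := ⟨b, by rw [hM, mul_comm]⟩
      have : ∀ z : ZMod M, ((z.val : ℕ) : ZMod m) = ZMod.castHom hdvd (ZMod m) z := fun z => by
        rw [ZMod.castHom_apply, ZMod.cast_eq_val]
      rw [this, this, this, map_sub]
    rw [hred]
    exact natAbs_cRepZ_red_le hM (x i - w i)
  have h3 := natAbs_cRepZ_apply_le_tnorm (x - w) i
  rw [Pi.sub_apply] at h3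
  omega

end Far

/-! ## §4 Tails from first moments -/

/-- **A tail over `{R < w}` is at most `(R + 1)⁻¹ ×` the `w`-weighted sum** (for an `ℕ`-valued weight `w`, e.g. `tnorm (site − site)`):
the tail `T` of `…TwoVolumeBlockDefect.norm_near_le` from a first spatial moment of the fine covariance. [folklore] -/
theorem sum_filter_le_div_of_weight {α : Type*} (s : Finset α) (f : α → ℝ) (w : α → ℕ) (hf : ∀ a ∈ s, 0 ≤ f a) (R : ℕ) :
    ∑ a ∈ s.filter (fun a => R < w a), f a ≤ ((R : ℝ) + 1)⁻¹ * ∑ a ∈ s, (w a : ℝ) * f a := by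
  have hR : (0 : ℝ) < (R : ℝ) + 1 := by positivity
  rw [mul_sum]
  calc ∑ a ∈ s.filter (fun a => R < w a), f a ≤ ∑ a ∈ s.filter (fun a => R < w a), ((R : ℝ) + 1)⁻¹ * ((w a : ℝ) * f a) := by
        refine sum_le_sum fun a ha => ?_
        simp only [mem_filter] at ha
        have hw : (R : ℝ) + 1 ≤ w a := by exact_mod_cast Nat.succ_le_of_lt ha.2
        rw [← mul_assoc]
        have h1 : 1 ≤ ((R : ℝ) + 1)⁻¹ * (w a : ℝ) := by
          rw [inv_mul_eq_div, le_div_iff₀ hR, one_mul]; exact hw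
        calc f a = 1 * f a := (one_mul _).symm
          _ ≤ ((R : ℝ) + 1)⁻¹ * (w a : ℝ) * f a := mul_le_mul_of_nonneg_right h1 (hf a ha.1)
    _ ≤ ∑ a ∈ s, ((R : ℝ) + 1)⁻¹ * ((w a : ℝ) * f a) :=
        sum_le_sum_of_subset_of_nonneg (filter_subset _ _) fun a ha _ => by
          have := hf a ha; positivity

end Summit.HubbardSuperconductivity.HubbardSuperconductivity.Theorems.TwoVolumeDefect

end
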